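import Mathlib
import HarnessLib

/-!
# Programme V3U, chart b: the augmentation ideal on `D₊(x_b² t)` is `(x_b)` — ANY characteristic

(crux stmt-ResolutionOfSingularities-15640 `WildQuotients.WildQuotientResolution`, line `Sketch`,
sector `|G| = p`; programme V3U of `L/w45c/CHAIN.md` v5 §4 row stub-2, candidate **D1** of
`W45cPlanSignaturesV5.lean` VERBATIM; [OURS · L1 W4.5c] — NOT a statement of any manuscript.)

On the regular chart `D₊(x_b² t) = Spec k[x_b, v, …]` (`x_a = v x_b²`) of `Bl_{(x_a, x_b²)} 𝔸ⁿ` the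
lifted `J₃`-type action `a` (`a x_a = x_a`, `a x_b = x_b + m x_a`, any `m`, any characteristic) has
`a x_b = x_b (1 + m x_b v)`, `a v · (1 + m x_b v)² = v`, so the ideal `(x_a, x_b) + (a v − v)` — the
augmentation ideal read through the chart package — is the principal ideal `(x_b)`
(`chartB_span_eq`; = stub-1's `JordanThree.k3_chart4_span_eq` with exponent `2` instead of `6`).
Hence the stable affine `W_b = ⋂ₗ σˡ D₊(x_b² t)` has a regular quotient by chart-level
Király–Lütkebohmert, at EVERY `p`.
-/

-- single-problem summit: the doubled namespace component `ResolutionOfSingularities` is forced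
set_option linter.dupNamespace false

noncomputable section

namespace Summit.ResolutionOfSingularities.ResolutionOfSingularities.Theorems.WildQuotientResolution.ToricExit

/-- **D1 — chart b of `Bl_{(x_a,x_b²)}`, augmentation ideal `(x_b)`** (V5 verbatim): in a domain with
`x_b² · e₀ = x_a` (`e₀ = v = x_a/x_b²` the chart generator), `a x_a = x_a`, `a x_b = x_b + m x_a`,
one has `(x_a, x_b) + (a e₀ − e₀) = (x_b)`: `x_a = x_b² v ∈ (x_b)`, `a x_b − x_b = m x_b² v`,
`a v − v = −a v (2 m x_b v + m² x_b² v²)` (from `a v (1 + m x_b v)² = v`). Any characteristic, any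
`m`. [OURS · L1 W4.5c] [folklore] -/
theorem chartB_span_eq {S : Type} [CommRing S] [IsDomain S] (xa xb m : S) (hxa : xa ≠ 0)
    (hxb : xb ≠ 0) (a : S →+* S) (ha : a xa = xa) (hb : a xb = xb + m * xa)
    (e : {l : Fin 2 // l ≠ (1 : Fin 2)} → S)
    (he : ∀ l, xb ^ 2 * e l = (![xa, xb ^ 2] : Fin 2 → S) l.1) :
    Ideal.span ({xa, xb} : Set S) ⊔ Ideal.span (Set.range fun l => a (e l) - e l) =
      Ideal.span ({xb} : Set S) := by
  set v : S := e ⟨0, by decide⟩ with hv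
  -- the monomial parametrisation `x_a = x_b² v`
  have hxa1 : xb ^ 2 * v = xa := he ⟨0, by decide⟩
  -- the action: `a x_b = x_b (1 + m x_b v)` and `a v · (1 + m x_b v)² = v`
  have hb' : a xb = xb * (1 + m * (xb * v)) := by rw [hb, ← hxa1]; ring
  have hav : a v * (1 + m * (xb * v)) ^ 2 = v := by
    have h := congrArg a hxa1
    rw [map_mul, map_pow, ha, hb', ← hxa1] at h
    have h' : xb ^ 2 * (a v * (1 + m * (xb * v)) ^ 2) = xb ^ 2 * v := by linear_combination h
    exact mul_left_cancel₀ (pow_ne_zero 2 hxb) h'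
  -- the moves land in `(x_b)`
  set I : Ideal S := Ideal.span ({xb} : Set S) with hI
  have hxbI : xb ∈ I := Ideal.subset_span (Set.mem_singleton _)
  have hmv : a v - v ∈ I := by
    refine Ideal.mem_span_singleton'.mpr ⟨-(a v * (2 * m * v + m ^ 2 * xb * v ^ 2)), ?_⟩
    linear_combination (-1 : S) * hav
  apply le_antisymm
  · refine sup_le ?_ ?_
    · refine Ideal.span_le.mpr ?_
      intro x hx
      simp only [Set.mem_insert_iff, Set.mem_singleton_iff] at hx
      rcases hx with rfl | rfl
      · rw [← hxa1]
        exact Ideal.mem_span_singleton'.mpr ⟨xb * v, by ring⟩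
      · exact hxbI
    · refine Ideal.span_le.mpr ?_
      rintro _ ⟨⟨l, hl⟩, rfl⟩
      fin_cases l
      · exact hmv
      · exact absurd rfl hl
  · rw [hI, Ideal.span_singleton_le_iff_mem]
    exact Ideal.mem_sup_left (Ideal.subset_span (Set.mem_insert_of_mem _ (Set.mem_singleton _)))

end Summit.ResolutionOfSingularities.ResolutionOfSingularities.Theorems.WildQuotientResolution.ToricExit

end
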